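import Summits.CriticalPhenomena.PercolationContinuityZ3.Theorems.SahiMasterFamilyFInequalityMSTightBlocks

/-!
# Equality in Marica–Schönheim, IV: every tight family has a pivot (structure theorem)

Support file for the master-family `F`-inequality programme (`prim-master-conj` gen 29; `--supports stmt-CriticalPhenomena-4575`;
memo `run/shared/lean/prim/prim-l12/prim-master-conj/MS-EQUALITY.md` §1).  No definition, no `sorry`, standard axioms.

THEOREM (`exists_pivot_of_card_diffs_eq_card`, new).  If a nonempty finite family `F` of finite sets attains equality in the
Marica–Schönheim inequality, `#(F \\ F) = #F`, then `F` has a PIVOT: a member `h ∈ F` with `h ∪ f ∈ F` and `h ∩ f ∈ F` for every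
`f ∈ F`.  Consequently (`union_sdiff_mem_of_card_diffs_eq_card`, with part II) `F = {(f ∩ h) ∪ (f' \ h) : f, f' ∈ F}` is the
product of its traces inside and outside `h`, `F \\ F = {(h \ f) ∪ (f' \ h)}`, the outside traces are closed under differences and
the inside traces are the complements in `h` of a difference-closed family — i.e. `F` is a translate of (blown-up up-set) ⊗
(blown-up down-set) (memo THEOREM (TCHAR); the converse "such products are tight" is immediate).  Ahlswede–Blinovsky (*Lectures on
Advances in Combinatorics*, p. 225, Research Problem 2) record the characterisation of the equality cases of Marica–Schönheim as
"started in [Aharoni–Holzman 1993]" and open to completion; we could not find this statement in print.  Census (gen 29, C code +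
kit job j180654): every tight family in `2^[4]` (717) and in `2^[5]` is of this form.

PROOF (memo §1.3), by strong induction on `#F`.  For a coordinate `r` in some but not all members, part I (Step 1) and part III give
a block `β ∋ r` which is DECREASING (members containing `β` stay in `F` when `β` is removed, the others miss `β`) when
`#P ≤ #Q`, using a pivot of the tight smaller-index family `Q = F.nonMemberSubfamily r` (induction), and INCREASING when `#Q ≤ #P`,
using a pivot of the complemented family `{K \ p : p ∈ P}` (induction; it is tight of size `#P < #F`).  `exists_pivot_of_blocks`
(Step 3) assembles a pivot from such blocks: with `G = ⋂ F` and `I` = the coordinates that are not decreasing, a member `h`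
minimising `#(I \ h) + #(h \ (I ∪ G))` equals `I ∪ G` and is a pivot (adding increasing blocks / removing decreasing blocks one at
a time).

HONEST FRAMING: a complete, kernel-checked proof of a characterisation we believe to be new or folklore; [this work].
-/

namespace Summit.CriticalPhenomena.PercolationContinuityZ3.Theorems

namespace TwistedAD

open Finset
open scoped FinsetFamily

variable {α : Type*} [DecidableEq α]

/-! ### Step 3: blocks assemble to a pivot -/

/-- If `β ∋ r` is an increasing block (`∀ f ∈ F`, `f` is disjoint from `β` with `f ∪ β ∈ F`, or `β ⊆ f`), `r` is not decreasing,
and some member misses `r`, then no element of `β` is decreasing either, every element of `β` lies in some member and outside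
some member. [this work] -/
theorem incBlock_subset (F : Finset (Finset α)) {r : α} {β : Finset α} (hrβ : r ∈ β)
    (hinc : ∀ f ∈ F, (Disjoint β f ∧ f ∪ β ∈ F) ∨ β ⊆ f)
    (hndec : ¬ ∃ β' : Finset α, r ∈ β' ∧ ∀ f ∈ F, (β' ⊆ f ∧ f \ β' ∈ F) ∨ Disjoint β' f)
    {f₀ : Finset α} (hf₀ : f₀ ∈ F) (hrf₀ : r ∉ f₀) :
    ∀ y ∈ β, (∃ f ∈ F, y ∈ f) ∧ (∃ f ∈ F, y ∉ f) ∧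
      ¬ ∃ β' : Finset α, y ∈ β' ∧ ∀ f ∈ F, (β' ⊆ f ∧ f \ β' ∈ F) ∨ Disjoint β' f := by
  have h0 : Disjoint β f₀ ∧ f₀ ∪ β ∈ F := by
    rcases hinc f₀ hf₀ with h | h
    · exact h
    · exact absurd (h hrβ) hrf₀
  intro y hy
  refine ⟨⟨f₀ ∪ β, h0.2, mem_union_right _ hy⟩, ⟨f₀, hf₀, fun hyf => disjoint_left.1 h0.1 hy hyf⟩, ?_⟩
  rintro ⟨β', hyβ', hdec'⟩
  -- `β'` misses `f₀`, sits inside `f₀ ∪ β`, hence inside `β`; the increasing dichotomy at `(f₀ ∪ β) \ β'` forces `β ⊆ β'`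
  have hd0 : Disjoint β' f₀ := by
    rcases hdec' f₀ hf₀ with h | h
    · exact absurd (h.1 hyβ') (fun hyf => disjoint_left.1 h0.1 hy hyf)
    · exact h
  have h1 : β' ⊆ f₀ ∪ β ∧ (f₀ ∪ β) \ β' ∈ F := by
    rcases hdec' (f₀ ∪ β) h0.2 with h | h
    · exact h
    · exact absurd (mem_union_right f₀ hy) (disjoint_left.1 h hyβ')
  have hβsub : β ⊆ β' := by
    rcases hinc ((f₀ ∪ β) \ β') h1.2 with h | h
    · intro z hz
      by_contra hzβ'
      exact disjoint_left.1 h.1 hz (mem_sdiff.2 ⟨mem_union_right f₀ hz, hzβ'⟩)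
    · exact absurd (h hy) (fun hmem => (mem_sdiff.1 hmem).2 hyβ')
  exact hndec ⟨β', hβsub hrβ, hdec'⟩

/-- **Step 3.**  If every coordinate lying in some but not all members of the nonempty family `F` admits a decreasing or an
increasing block, then `F` has a pivot. [this work] -/
theorem exists_pivot_of_blocks (F : Finset (Finset α)) (hne : F.Nonempty)
    (hblk : ∀ r, (∃ f ∈ F, r ∈ f) → (∃ f ∈ F, r ∉ f) →
      (∃ β : Finset α, r ∈ β ∧ ∀ f ∈ F, (β ⊆ f ∧ f \ β ∈ F) ∨ Disjoint β f) ∨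
      (∃ β : Finset α, r ∈ β ∧ ∀ f ∈ F, (Disjoint β f ∧ f ∪ β ∈ F) ∨ β ⊆ f)) :
    ∃ h ∈ F, ∀ f ∈ F, h ∪ f ∈ F ∧ h ∩ f ∈ F := by
  classical
  -- `Dec x`: `x` has a decreasing block
  let Dec : α → Prop := fun x => ∃ β : Finset α, x ∈ β ∧ ∀ f ∈ F, (β ⊆ f ∧ f \ β ∈ F) ∨ Disjoint β f
  set G := (F.biUnion id).filter (fun x => ∀ f ∈ F, x ∈ f) with hGdef
  set I := (F.biUnion id).filter (fun x => (∃ f ∈ F, x ∉ f) ∧ ¬ Dec x) with hIdef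
  have hGsub : ∀ f ∈ F, G ⊆ f := fun f hf x hx => (mem_filter.1 hx).2 f hf
  -- `x ∉ I`, `x` in some and outside some member ⟹ `Dec x`
  have hDec_of : ∀ x, (∃ f ∈ F, x ∈ f) → (∃ f ∈ F, x ∉ f) → x ∉ I → Dec x := by
    intro x hx1 hx2 hxI
    by_contra hnd
    apply hxI
    rw [hIdef, mem_filter, mem_biUnion]
    obtain ⟨f, hf, hxf⟩ := hx1
    exact ⟨⟨f, hf, hxf⟩, hx2, hnd⟩
  -- increasing blocks at non-decreasing coordinates lie inside `I`
  have hIncI : ∀ r β, r ∈ β → (∀ f ∈ F, (Disjoint β f ∧ f ∪ β ∈ F) ∨ β ⊆ f) → ¬ Dec r →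
      ∀ f₀ ∈ F, r ∉ f₀ → β ⊆ I := by
    intro r β hrβ hinc hnd f₀ hf₀ hrf₀ y hy
    obtain ⟨hy1, hy2, hy3⟩ := incBlock_subset F hrβ hinc hnd hf₀ hrf₀ y hy
    rw [hIdef, mem_filter, mem_biUnion]
    obtain ⟨f, hf, hyf⟩ := hy1
    exact ⟨⟨f, hf, hyf⟩, hy2, hy3⟩
  -- decreasing blocks avoid `I ∪ G`
  have hDecIG : ∀ β : Finset α, (∀ f ∈ F, (β ⊆ f ∧ f \ β ∈ F) ∨ Disjoint β f) →
      ∀ f₀ ∈ F, β ⊆ f₀ → ∀ y ∈ β, y ∉ I ∧ y ∉ G := by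
    intro β hdec f₀ hf₀ hβf₀ y hy
    have hmem : f₀ \ β ∈ F := by
      rcases hdec f₀ hf₀ with h | h
      · exact h.2
      · exact absurd (hβf₀ hy) (disjoint_left.1 h hy)
    refine ⟨fun hyI => ?_, fun hyG => (mem_sdiff.1 (hGsub _ hmem hyG)).2 hy⟩
    rw [hIdef, mem_filter] at hyI
    exact hyI.2.2 ⟨β, hy, hdec⟩
  -- the pivot: a member minimising `μ`
  obtain ⟨h, hh, hmin⟩ := exists_min_image F (fun f => #(I \ f) + #(f \ (I ∪ G))) hne
  have hIh : I ⊆ h := by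
    intro r hrI
    by_contra hrh
    have hrI' := hrI
    rw [hIdef, mem_filter, mem_biUnion] at hrI'
    obtain ⟨⟨f₁, hf₁, hrf₁⟩, hr2, hrnd⟩ := hrI'
    rcases hblk r ⟨f₁, hf₁, by simpa using hrf₁⟩ hr2 with hdec | ⟨β, hrβ, hinc⟩
    · exact hrnd hdec
    · have h0 : Disjoint β h ∧ h ∪ β ∈ F := by
        rcases hinc h hh with h' | h'
        · exact h'
        · exact absurd (h' hrβ) hrh
      have hβI : β ⊆ I := hIncI r β hrβ hinc hrnd h hh hrh
      have hlt : #(I \ (h ∪ β)) + #((h ∪ β) \ (I ∪ G)) < #(I \ h) + #(h \ (I ∪ G)) := by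
        have h1 : #(I \ (h ∪ β)) < #(I \ h) := by
          apply card_lt_card
          refine ⟨fun x hx => mem_sdiff.2 ⟨(mem_sdiff.1 hx).1, fun hxh => (mem_sdiff.1 hx).2 (mem_union_left _ hxh)⟩, ?_⟩
          intro hsub
          have := hsub (mem_sdiff.2 ⟨hrI, hrh⟩)
          exact (mem_sdiff.1 this).2 (mem_union_right _ hrβ)
        have h2 : (h ∪ β) \ (I ∪ G) = h \ (I ∪ G) := by
          ext x
          simp only [mem_sdiff, mem_union]
          constructor
          · rintro ⟨hx | hx, hx'⟩
            · exact ⟨hx, hx'⟩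
            · exact absurd (Or.inl (hβI hx)) hx'
          · rintro ⟨hx, hx'⟩
            exact ⟨Or.inl hx, hx'⟩
        rw [h2]; omega
      exact absurd (hmin _ h0.2) (not_le.2 hlt)
  have hhIG : h ⊆ I ∪ G := by
    intro x hxh
    by_contra hx
    rw [mem_union, not_or] at hx
    have hx1 : ∃ f ∈ F, x ∈ f := ⟨h, hh, hxh⟩
    have hx2 : ∃ f ∈ F, x ∉ f := by
      by_contra hall
      apply hx.2
      rw [hGdef, mem_filter, mem_biUnion]
      exact ⟨⟨h, hh, hxh⟩, fun f hf => by by_contra hxf; exact hall ⟨f, hf, hxf⟩⟩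
    obtain ⟨β, hxβ, hdec⟩ := hDec_of x hx1 hx2 hx.1
    have h0 : β ⊆ h ∧ h \ β ∈ F := by
      rcases hdec h hh with h' | h'
      · exact h'
      · exact absurd hxh (disjoint_left.1 h' hxβ)
    have hβIG := hDecIG β hdec h hh h0.1
    have hlt : #(I \ (h \ β)) + #((h \ β) \ (I ∪ G)) < #(I \ h) + #(h \ (I ∪ G)) := by
      have h1 : I \ (h \ β) = I \ h := by
        ext y
        simp only [mem_sdiff]
        constructor
        · rintro ⟨hyI, hy⟩
          exact ⟨hyI, fun hyh => hy ⟨hyh, fun hyβ => (hβIG y hyβ).1 hyI⟩⟩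
        · rintro ⟨hyI, hyh⟩
          exact ⟨hyI, fun hy => hyh hy.1⟩
      have h2 : #((h \ β) \ (I ∪ G)) < #(h \ (I ∪ G)) := by
        apply card_lt_card
        refine ⟨fun y hy => mem_sdiff.2 ⟨(mem_sdiff.1 (mem_sdiff.1 hy).1).1, (mem_sdiff.1 hy).2⟩, ?_⟩
        intro hsub
        have := hsub (mem_sdiff.2 ⟨hxh, by rw [mem_union, not_or]; exact hx⟩)
        exact (mem_sdiff.1 (mem_sdiff.1 this).1).2 hxβ
      rw [h1]; omega
    exact absurd (hmin _ h0.2) (not_le.2 hlt)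
  refine ⟨h, hh, fun f hf => ⟨?_, ?_⟩⟩
  · -- `h ∪ f ∈ F`, by induction on `#(h \ f)`
    suffices H : ∀ n, ∀ g ∈ F, #(h \ g) = n → h ∪ g ∈ F from H _ f hf rfl
    intro n
    induction n using Nat.strong_induction_on with
    | _ n ih =>
      intro g hg hgn
      by_cases hempty : h \ g = ∅
      · rw [union_eq_right.2 (sdiff_eq_empty_iff_subset.1 hempty)]; exact hg
      · obtain ⟨r, hr⟩ := nonempty_iff_ne_empty.2 hempty
        obtain ⟨hrh, hrg⟩ := mem_sdiff.1 hr
        have hrI : r ∈ I := by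
          rcases mem_union.1 (hhIG hrh) with h' | h'
          · exact h'
          · exact absurd (hGsub g hg h') hrg
        have hrI' := hrI
        rw [hIdef, mem_filter, mem_biUnion] at hrI'
        obtain ⟨⟨f₁, hf₁, hrf₁⟩, -, hrnd⟩ := hrI'
        rcases hblk r ⟨f₁, hf₁, by simpa using hrf₁⟩ ⟨g, hg, hrg⟩ with hdec | ⟨β, hrβ, hinc⟩
        · exact absurd hdec hrnd
        · have h0 : Disjoint β g ∧ g ∪ β ∈ F := by
            rcases hinc g hg with h' | h'
            · exact h'
            · exact absurd (h' hrβ) hrg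
          have hβh : β ⊆ h := (hIncI r β hrβ hinc hrnd g hg hrg).trans hIh
          have hlt : #(h \ (g ∪ β)) < n := by
            rw [← hgn]
            apply card_lt_card
            refine ⟨fun x hx => mem_sdiff.2 ⟨(mem_sdiff.1 hx).1, fun hxg => (mem_sdiff.1 hx).2 (mem_union_left _ hxg)⟩, ?_⟩
            intro hsub
            exact (mem_sdiff.1 (hsub hr)).2 (mem_union_right _ hrβ)
          have := ih _ hlt (g ∪ β) h0.2 rfl
          have heq : h ∪ (g ∪ β) = h ∪ g := by
            ext y
            simp only [mem_union]
            constructor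
            · rintro (hy | hy | hy)
              · exact Or.inl hy
              · exact Or.inr hy
              · exact Or.inl (hβh hy)
            · rintro (hy | hy)
              · exact Or.inl hy
              · exact Or.inr (Or.inl hy)
          rwa [heq] at this
  · -- `h ∩ f ∈ F`, by induction on `#(f \ h)`
    suffices H : ∀ n, ∀ g ∈ F, #(g \ h) = n → h ∩ g ∈ F from H _ f hf rfl
    intro n
    induction n using Nat.strong_induction_on with
    | _ n ih =>
      intro g hg hgn
      by_cases hempty : g \ h = ∅
      · rw [inter_eq_right.2 (sdiff_eq_empty_iff_subset.1 hempty)]; exact hg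
      · obtain ⟨x, hx⟩ := nonempty_iff_ne_empty.2 hempty
        obtain ⟨hxg, hxh⟩ := mem_sdiff.1 hx
        have hxI : x ∉ I := fun h' => hxh (hIh h')
        obtain ⟨β, hxβ, hdec⟩ := hDec_of x ⟨g, hg, hxg⟩ ⟨h, hh, hxh⟩ hxI
        have h0 : β ⊆ g ∧ g \ β ∈ F := by
          rcases hdec g hg with h' | h'
          · exact h'
          · exact absurd hxg (disjoint_left.1 h' hxβ)
        have hβh : Disjoint β h := by
          rcases hdec h hh with h' | h'
          · exact absurd (h'.1 hxβ) hxh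
          · exact h'
        have hlt : #((g \ β) \ h) < n := by
          rw [← hgn]
          apply card_lt_card
          refine ⟨fun y hy => mem_sdiff.2 ⟨(mem_sdiff.1 (mem_sdiff.1 hy).1).1, (mem_sdiff.1 hy).2⟩, ?_⟩
          intro hsub
          exact (mem_sdiff.1 (mem_sdiff.1 (hsub hx)).1).2 hxβ
        have := ih _ hlt (g \ β) h0.2 rfl
        have heq : h ∩ (g \ β) = h ∩ g := by
          ext y
          simp only [mem_inter, mem_sdiff]
          constructor
          · rintro ⟨hyh, hyg, -⟩; exact ⟨hyh, hyg⟩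
          · rintro ⟨hyh, hyg⟩; exact ⟨hyh, hyg, fun hyβ => disjoint_left.1 hβh hyβ hyh⟩
        rwa [heq] at this

/-! ### The structure theorem -/

/-- Members of the member-section `F.memberSubfamily r` lie inside `(⋃ F).erase r`. [this work] -/
theorem memberSubfamily_subset_erase_biUnion (F : Finset (Finset α)) (r : α) :
    ∀ p ∈ F.memberSubfamily r, p ⊆ (F.biUnion id).erase r := by
  intro p hp x hx
  rw [mem_memberSubfamily] at hp
  rw [mem_erase]
  refine ⟨fun hxr => hp.2 (hxr ▸ hx), ?_⟩
  rw [mem_biUnion]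
  exact ⟨insert r p, hp.1, mem_insert_of_mem hx⟩

/-- **Equality in Marica–Schönheim forces a pivot.**  If `F` is a nonempty finite family of finite sets with `#(F \\ F) = #F`,
then some `h ∈ F` satisfies `h ∪ f ∈ F` and `h ∩ f ∈ F` for all `f ∈ F`. [this work] -/
theorem exists_pivot_of_card_diffs_eq_card (F : Finset (Finset α)) (htight : #(F \\ F) = #F) (hne : F.Nonempty) :
    ∃ h ∈ F, ∀ f ∈ F, h ∪ f ∈ F ∧ h ∩ f ∈ F := by
  suffices H : ∀ n, ∀ G : Finset (Finset α), #G = n → #(G \\ G) = #G → G.Nonempty →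
      ∃ h ∈ G, ∀ f ∈ G, h ∪ f ∈ G ∧ h ∩ f ∈ G from H _ F rfl htight hne
  intro n
  induction n using Nat.strong_induction_on with
  | _ n ih =>
    intro G hGn hGt hGne
    apply exists_pivot_of_blocks G hGne
    intro r hr1 hr2
    -- both sections are nonempty
    have hP : (G.memberSubfamily r).Nonempty := by
      obtain ⟨f, hf, hrf⟩ := hr1
      exact ⟨f.erase r, mem_memberSubfamily.2 ⟨by rwa [insert_erase hrf], notMem_erase r f⟩⟩
    have hQ : (G.nonMemberSubfamily r).Nonempty := by
      obtain ⟨f, hf, hrf⟩ := hr2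
      exact ⟨f, mem_nonMemberSubfamily.2 ⟨hf, hrf⟩⟩
    have hPQ : #(G.memberSubfamily r) + #(G.nonMemberSubfamily r) = n := by
      rw [card_memberSubfamily_add_card_nonMemberSubfamily, hGn]
    have hP1 : 1 ≤ #(G.memberSubfamily r) := card_pos.2 hP
    have hQ1 : 1 ≤ #(G.nonMemberSubfamily r) := card_pos.2 hQ
    by_cases hle : #(G.memberSubfamily r) ≤ #(G.nonMemberSubfamily r)
    · left
      refine exists_decreasing_block G hGt r hP hle ?_
      obtain ⟨hQt, -, -, -⟩ := tight_section_of_card_le G r hGt hP hle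
      exact ih _ (by omega) (G.nonMemberSubfamily r) rfl hQt hQ
    · right
      have hge : #(G.nonMemberSubfamily r) ≤ #(G.memberSubfamily r) := le_of_not_ge hle
      refine exists_increasing_block G hGt r hQ hge ?_
      obtain ⟨hPt, -, -, -⟩ := tight_section_of_card_ge G r hGt hQ hge
      set K := (G.biUnion id).erase r with hK
      have hPK := memberSubfamily_subset_erase_biUnion G r
      have hcard : #((G.memberSubfamily r).image fun g => K \ g) = #(G.memberSubfamily r) :=
        card_image_sdiff_eq K _ hPK
      have ht' : #(((G.memberSubfamily r).image fun g => K \ g) \\ ((G.memberSubfamily r).image fun g => K \ g))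
          = #((G.memberSubfamily r).image fun g => K \ g) := by
        rw [diffs_image_sdiff_eq K _ _ hPK, hcard, hPt]
      exact ih _ (by rw [hcard]; omega) _ rfl ht' (hP.image _)

/-- **Product structure of tight families.**  If `#(F \\ F) = #F` and `F` is nonempty, there is `h ∈ F` such that
`(f ∩ h) ∪ (f' \ h) ∈ F` for all `f, f' ∈ F` — `F` is the product of its traces inside and outside `h` — and such that every
difference is `(h \ f) ∪ (f' \ h)` for some `f, f' ∈ F`. [this work] -/
theorem exists_product_of_card_diffs_eq_card (F : Finset (Finset α)) (htight : #(F \\ F) = #F) (hne : F.Nonempty) :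
    ∃ h ∈ F, (∀ f ∈ F, ∀ f' ∈ F, (f ∩ h) ∪ (f' \ h) ∈ F) ∧
      ∀ e ∈ F \\ F, ∃ f ∈ F, ∃ f' ∈ F, e = (h \ f) ∪ (f' \ h) := by
  obtain ⟨h, hh, hpiv⟩ := exists_pivot_of_card_diffs_eq_card F htight hne
  exact ⟨h, hh, fun f hf f' hf' => union_sdiff_mem_of_pivot F htight h hpiv hf hf',
    fun e he => exists_eq_union_of_mem_diffs_of_pivot F htight h hpiv he⟩

/-- **The (AMS-3) non-absorption test, unconditional form.**  If `#(F \\ F) = #F`, `F` nonempty, then there is `h ∈ F` such that for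
every set `x`: `h \ x ∈ F \\ F` and `x \ h ∈ F \\ F` together imply `x ∈ F`.  (So a tight family cannot contain both differences
with a set outside it.) [this work] -/
theorem exists_witness_of_card_diffs_eq_card (F : Finset (Finset α)) (htight : #(F \\ F) = #F) (hne : F.Nonempty) :
    ∃ h ∈ F, ∀ x : Finset α, h \ x ∈ F \\ F → x \ h ∈ F \\ F → x ∈ F := by
  obtain ⟨h, hh, hpiv⟩ := exists_pivot_of_card_diffs_eq_card F htight hne
  exact ⟨h, hh, fun x hx1 hx2 => mem_of_sdiff_mem_diffs F htight h hpiv hx1 hx2⟩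

end TwistedAD

end Summit.CriticalPhenomena.PercolationContinuityZ3.Theorems
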